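import Literature.AlgebraicGeometry.Motives.FaltingsECTateLemma1Proofs
import Literature.NumberTheory.EllipticCurves.IsogenyCompProofs
import Mathlib.Data.Fintype.Pigeonhole
import Mathlib.Order.Interval.Finset.Nat
import HarnessLib

/-!
# Tate 1966, §2 Proposition 1 for elliptic curves: endomorphisms approximating a line

Sibling file of `Literature.AlgebraicGeometry.Motives.FaltingsEC` (D-0014), serving the
decomposition of `Literature.AlgebraicGeometry.Motives.mem_span_range_tateModule_map_of_equivariant_of_finite` (Tate's
theorem for elliptic curves over a finite field, Tate, Invent. Math. 2 (1966), Main Theorem).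

This file carries out the **geometric construction** in Tate's proof of his Proposition 1
(loc. cit., §2, pp. 136–137) for an elliptic curve `E` over a finite field `k` (so `g = 1`, every
line of `V_ℓ E` is isotropic, and the finiteness hypothesis `Hyp(k, A, d, ℓ)` is replaced by the
finiteness of the set of Weierstrass curves over `k`), from one geometric input supplied as a
hypothesis (`hquot`, the body of the named fact on quotient isogenies, Silverman, *AEC*,
Prop. III.4.12 with Rem. III.4.13.2 and Thm. III.6.1–6.2): for a finite `Γ_k`-stable subgroup
`S ⊆ E(k̄)` there are an elliptic curve `E'` over `k` and isogenies `g : E → E'`, `f : E' → E`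
over `k` with `ker g = S`, `f ∘ g = [#S]`, `g ∘ f = [#S]`.

Let `v ∈ T = T_ℓ E` be primitive (`v_1 ≠ 0`) with `Γ_k`-stable reductions
`S_n = ⟨v_n⟩ ⊆ E[ℓ^n]` (cyclic of order `ℓ^n`), and put `Λ = ℤ_ℓ v`, `X_n = Λ + ℓ^n T` (Tate's
`X_n = (T ∩ W) + ℓ^n T` for the line `W = ℚ_ℓ v`). With `g_n : E → B_n = E/S_n` and
`f_n : B_n → E` as above (`f_n g_n = ℓ^n`, `g_n f_n = ℓ^n`):

* `Literature.AlgebraicGeometry.Motives.exists_tateModule_map_eq_of_ker_eq` and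
  `Literature.AlgebraicGeometry.Motives.exists_tateModule_map_eq_add_of_ker_eq`: `f_n (T_ℓ B_n) = X_n`, in the form
  `v ∈ f_n(T_ℓ B_n) ⊆ Λ + ℓ^n T` (Tate: "an isogeny `f_n : B_n → A` ... such that
  `f_n(T_ℓ(B_n)) = X_n`");
* `Literature.AlgebraicGeometry.Motives.exists_isogeny_tateModule_map_approx` (**Proposition 1, construction**): since `k`
  is finite there are only finitely many Weierstrass curves over `k`, so one curve `B` equals
  `B_n` for all `n` in an infinite set `I` (Tate: "by `Hyp` ... there exists an infinite set `I` of
  positive integers such that for `i ∈ I` the `B_i` are all isomorphic"); for `n₀ ∈ I` and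
  `m ∈ I`, `m ≥ k`, the endomorphism `φ = f_m ∘ g_{n₀}` of `E` over `k` (Tate's
  `u_i = f_i v_i f_n⁻¹`, multiplied by `ℓ^{n₀}`) satisfies `T_ℓ(φ)(T) ⊆ Λ + ℓ^k T` and takes
  the value `ℓ^{n₀} v`. The passage to the limit (Tate: "since `End(X_n)` is compact ...") is
  the separate, purely `ℓ`-adic statement `Literature.AlgebraicGeometry.Motives.FinTwo.exists_ne_zero_forall_mem_span_of_approx`.

Also: `Literature.AlgebraicGeometry.Motives.finite_weierstrassCurve` (a finite field carries finitely many Weierstrass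
curves) and the order computation `Literature.AlgebraicGeometry.Motives.card_zmultiples_proj` (`#⟨v_n⟩ = ℓ^n` for
primitive `v`).

## References

* [Tate1966Endomorphisms] J. Tate, *Endomorphisms of abelian varieties over finite fields*,
  Invent. Math. 2 (1966), 134–144, §2, Proposition 1 and its proof.
* [SilvermanAEC2009] J. H. Silverman, *The Arithmetic of Elliptic Curves*, 2nd ed., GTM 106,
  Prop. III.4.12, Rem. III.4.13.2, Thm. III.6.1, Thm. III.6.2.
-/

noncomputable section

open scoped Classical

universe u

namespace Literature.AlgebraicGeometry.Motives

open WeierstrassCurve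

/-- Over a finite field there are only finitely many Weierstrass curves (five coefficients).
This replaces Tate's finiteness hypothesis `Hyp(k, A, d, ℓ)` for `g = 1`
(Tate, Invent. Math. 2 (1966), §2, p. 136). [folklore] -/
theorem finite_weierstrassCurve {K : Type u} [Finite K] : Finite (WeierstrassCurve K) :=
  Finite.of_injective (fun W : WeierstrassCurve K ↦ (W.a₁, W.a₂, W.a₃, W.a₄, W.a₆))
    fun W₁ W₂ h ↦ by
      simp only [Prod.mk.injEq] at h
      exact WeierstrassCurve.ext h.1 h.2.1 h.2.2.1 h.2.2.2.1 h.2.2.2.2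

variable {K : Type u} [Field K] {W : WeierstrassCurve K} (ℓ : ℕ) [Fact ℓ.Prime]

/-- For `v ∈ T_ℓ E` with `v_1 ≠ 0` (a primitive vector), the component `v_n ∈ E[ℓ^n]` has order
exactly `ℓ ^ n`, so the cyclic group `⟨v_n⟩` has `ℓ ^ n` elements. [folklore] -/
theorem card_zmultiples_proj {v : W.tateModule ℓ} (hv : Literature.NumberTheory.EllipticCurves.TateModule.proj ℓ 1 v ≠ 0) (n : ℕ) :
    Nat.card (AddSubgroup.zmultiples (Literature.NumberTheory.EllipticCurves.TateModule.proj ℓ n v)) = ℓ ^ n := by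
  rw [Nat.card_zmultiples]
  cases n with
  | zero =>
    have h0 : Literature.NumberTheory.EllipticCurves.TateModule.proj ℓ 0 v = 0 := by
      have := Literature.NumberTheory.EllipticCurves.TateModule.pow_smul_proj 0 v
      rwa [pow_zero, one_smul] at this
    rw [h0, addOrderOf_zero, pow_zero]
  | succ n =>
    refine addOrderOf_eq_prime_pow (fun h ↦ hv ?_) (Literature.NumberTheory.EllipticCurves.TateModule.pow_smul_proj (n + 1) v)
    rwa [Literature.NumberTheory.EllipticCurves.TateModule.pow_smul_proj_self_add n 1 v] at h

/-- The Galois action commutes with integer multiples on `E(K̄)`, so the cyclic group generated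
by `P` is `Γ_K`-stable as soon as `σ • P ∈ ⟨P⟩` for all `σ`. [folklore] -/
theorem smul_mem_zmultiples_of_smul_mem {P : W.geomPoints}
    (h : ∀ σ : Field.absoluteGaloisGroup K, σ • P ∈ AddSubgroup.zmultiples P)
    (σ : Field.absoluteGaloisGroup K) {Q : W.geomPoints} (hQ : Q ∈ AddSubgroup.zmultiples P) :
    σ • Q ∈ AddSubgroup.zmultiples P := by
  obtain ⟨k, rfl⟩ := AddSubgroup.mem_zmultiples_iff.mp hQ
  rw [← smul_comm k σ P]
  exact AddSubgroup.zsmul_mem _ (h σ) k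

/-! ## The lattice `f_n (T_ℓ B_n) = ℤ_ℓ v + ℓ^n T_ℓ E` -/

section Lattice

variable {B : WeierstrassCurve K} {g : Isogeny W B} {f : Isogeny B W} {n : ℕ} {v : W.tateModule ℓ}

/-- **`v ∈ f_n(T_ℓ B_n)`.** If `ker g = ⟨v_n⟩` and `f ∘ g = [ℓ^n]`, then `v = T_ℓ(f) y` for the
compatible system `y = (g v_{m+n})_m ∈ T_ℓ B`. Tate, Invent. Math. 2 (1966), §2, proof of
Proposition 1 (`f_n(T_ℓ(B_n)) = X_n ∋ T ∩ W`). [folklore] -/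
theorem exists_tateModule_map_eq_of_ker_eq
    (hker : ∀ P, g P = 0 ↔ P ∈ AddSubgroup.zmultiples (Literature.NumberTheory.EllipticCurves.TateModule.proj ℓ n v))
    (hfg : ∀ P, f (g P) = ℓ ^ n • P) :
    ∃ y : B.tateModule ℓ, Literature.NumberTheory.EllipticCurves.TateModule.map ℓ f.toAddMonoidHom y = v := by
  have h1 : ∀ m, ℓ ^ m • g (Literature.NumberTheory.EllipticCurves.TateModule.proj ℓ (m + n) v) = 0 := fun m ↦ by
    rw [← map_nsmul, Literature.NumberTheory.EllipticCurves.TateModule.pow_smul_proj_self_add m n v]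
    exact (hker _).mpr (AddSubgroup.mem_zmultiples _)
  have h2 : ∀ m, ℓ • g (Literature.NumberTheory.EllipticCurves.TateModule.proj ℓ (m + 1 + n) v) = g (Literature.NumberTheory.EllipticCurves.TateModule.proj ℓ (m + n) v) :=
    fun m ↦ by
      rw [← map_nsmul, show m + 1 + n = (m + n) + 1 by ring, Literature.NumberTheory.EllipticCurves.TateModule.smul_proj_succ]
  refine ⟨Literature.NumberTheory.EllipticCurves.TateModule.mk (fun m ↦ g (Literature.NumberTheory.EllipticCurves.TateModule.proj ℓ (m + n) v)) h1 h2, Literature.NumberTheory.EllipticCurves.TateModule.ext fun m ↦ ?_⟩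
  rw [Literature.NumberTheory.EllipticCurves.TateModule.proj_map, Literature.NumberTheory.EllipticCurves.TateModule.proj_mk, Isogeny.coe_toAddMonoidHom, hfg, add_comm,
    Literature.NumberTheory.EllipticCurves.TateModule.pow_smul_proj_self_add]

/-- **`f_n(T_ℓ B_n) ⊆ ℤ_ℓ v + ℓ^n T_ℓ E`.** If `ker g = ⟨v_n⟩` and `g ∘ f = [ℓ^n]`, then for
`y ∈ T_ℓ B` the `n`-th component `f(y_n)` of `T_ℓ(f) y` is killed by `g`, so it is a multiple
`k v_n`, and `T_ℓ(f) y - k v ∈ ker (T_ℓ E → E[ℓ^n]) = ℓ^n T_ℓ E`. Tate, Invent. Math. 2 (1966),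
§2, proof of Proposition 1 (`f_n(T_ℓ(B_n)) = X_n = (T ∩ W) + ℓ^n T`). [folklore] -/
theorem exists_tateModule_map_eq_add_of_ker_eq
    (hker : ∀ P, g P = 0 ↔ P ∈ AddSubgroup.zmultiples (Literature.NumberTheory.EllipticCurves.TateModule.proj ℓ n v))
    (hgf : ∀ Q, g (f Q) = ℓ ^ n • Q) (y : B.tateModule ℓ) :
    ∃ (a : ℤ_[ℓ]) (z : W.tateModule ℓ),
      Literature.NumberTheory.EllipticCurves.TateModule.map ℓ f.toAddMonoidHom y = a • v + (ℓ : ℤ_[ℓ]) ^ n • z := by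
  have h0 : g (f (Literature.NumberTheory.EllipticCurves.TateModule.proj ℓ n y)) = 0 := by rw [hgf, Literature.NumberTheory.EllipticCurves.TateModule.pow_smul_proj]
  obtain ⟨k, hk⟩ := AddSubgroup.mem_zmultiples_iff.mp ((hker _).mp h0)
  have hproj : Literature.NumberTheory.EllipticCurves.TateModule.proj ℓ n (Literature.NumberTheory.EllipticCurves.TateModule.map ℓ f.toAddMonoidHom y - (k : ℤ_[ℓ]) • v) = 0 := by
    rw [map_sub, Literature.NumberTheory.EllipticCurves.TateModule.proj_map, Literature.NumberTheory.EllipticCurves.TateModule.proj_intCast_smul, Isogeny.coe_toAddMonoidHom,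
      ← hk, sub_self]
  obtain ⟨z, hz⟩ := Literature.NumberTheory.EllipticCurves.TateModule.exists_pow_smul_eq_of_proj_eq_zero hproj
  exact ⟨k, z, by rw [hz, add_sub_cancel]⟩

end Lattice

/-! ## Proposition 1: the construction -/

/-- **Tate 1966, Proposition 1 for an elliptic curve over a finite field: the construction.**
Let `E` be an elliptic curve over a finite field `k`, `ℓ` a prime, and assume quotient isogenies
over `k` exist (hypothesis `hquot`, Silverman, *AEC*, Prop. III.4.12, Rem. III.4.13.2,
Thm. III.6.1–6.2: for a finite `Γ_k`-stable subgroup `S ⊆ E(k̄)` there are an elliptic curve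
`E'/k` and isogenies `g : E → E'`, `f : E' → E` over `k` with `ker g = S`, `f g = [#S]`,
`g f = [#S]`). Let `v ∈ T_ℓ E` be primitive (`v_1 ≠ 0`) with `Γ_k`-stable reductions
`⟨v_n⟩ ⊆ E[ℓ^n]`. Then there is `n₀` such that for every `k` some endomorphism `φ` of `E` over
`k` has `T_ℓ(φ)(T_ℓ E) ⊆ ℤ_ℓ v + ℓ^k T_ℓ E` and takes the value `ℓ^{n₀} v`. (Namely
`φ = f_m ∘ g_{n₀}` where `E/⟨v_{n₀}⟩` and `E/⟨v_m⟩`, `m ≥ k`, are the same curve `B`, which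
happens for infinitely many `m` because `k` has only finitely many Weierstrass curves.)
Tate, Invent. Math. 2 (1966), §2, Proposition 1 and its proof (`u_i = f_i v_i f_n⁻¹`,
`u_i(X_n) = X_i`). [cite: Tate1966Endomorphisms, §2 Proposition 1] -/
theorem exists_isogeny_tateModule_map_approx [Finite K] [W.IsElliptic]
    (hquot : ∀ S : AddSubgroup W.geomPoints, (S : Set W.geomPoints).Finite →
      (∀ (σ : Field.absoluteGaloisGroup K) (P : W.geomPoints), P ∈ S → σ • P ∈ S) →
      ∃ (W' : WeierstrassCurve K) (_ : W'.IsElliptic) (g : Isogeny W W') (f : Isogeny W' W),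
        g.toAddMonoidHom.ker = S ∧ (∀ P, f (g P) = Nat.card S • P) ∧
          ∀ Q, g (f Q) = Nat.card S • Q)
    {v : W.tateModule ℓ} (hv : Literature.NumberTheory.EllipticCurves.TateModule.proj ℓ 1 v ≠ 0)
    (hstab : ∀ (n : ℕ) (σ : Field.absoluteGaloisGroup K),
      σ • Literature.NumberTheory.EllipticCurves.TateModule.proj ℓ n v ∈ AddSubgroup.zmultiples (Literature.NumberTheory.EllipticCurves.TateModule.proj ℓ n v)) :
    ∃ n₀ : ℕ, ∀ k : ℕ, ∃ φ : Isogeny W W,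
      (∃ x : W.tateModule ℓ, Literature.NumberTheory.EllipticCurves.TateModule.map ℓ φ.toAddMonoidHom x = (ℓ : ℤ_[ℓ]) ^ n₀ • v) ∧
      ∀ x : W.tateModule ℓ, ∃ (a : ℤ_[ℓ]) (z : W.tateModule ℓ),
        Literature.NumberTheory.EllipticCurves.TateModule.map ℓ φ.toAddMonoidHom x = a • v + (ℓ : ℤ_[ℓ]) ^ k • z := by
  haveI : Finite (WeierstrassCurve K) := finite_weierstrassCurve
  -- the quotients `E → B_n = E / ⟨v_n⟩ → E`
  have hP : ∀ n : ℕ, ∃ (B : WeierstrassCurve K) (_ : B.IsElliptic) (g : Isogeny W B)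
      (f : Isogeny B W), (∀ P, g P = 0 ↔ P ∈ AddSubgroup.zmultiples (Literature.NumberTheory.EllipticCurves.TateModule.proj ℓ n v)) ∧
        (∀ P, f (g P) = ℓ ^ n • P) ∧ ∀ Q, g (f Q) = ℓ ^ n • Q := by
    intro n
    have hcard := card_zmultiples_proj ℓ hv n
    have hfin : ((AddSubgroup.zmultiples (Literature.NumberTheory.EllipticCurves.TateModule.proj ℓ n v) : AddSubgroup W.geomPoints) :
        Set W.geomPoints).Finite := by
      have : Finite (AddSubgroup.zmultiples (Literature.NumberTheory.EllipticCurves.TateModule.proj ℓ n v)) :=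
        Nat.finite_of_card_ne_zero (by rw [hcard]; exact pow_ne_zero _ (Fact.out : ℓ.Prime).ne_zero)
      exact Set.toFinite _
    obtain ⟨B, hB, g, f, hker, hfg, hgf⟩ := hquot _ hfin
      (fun σ P hP ↦ smul_mem_zmultiples_of_smul_mem (hstab n) σ hP)
    refine ⟨B, hB, g, f, fun P ↦ ?_, fun P ↦ by rw [hfg, hcard], fun Q ↦ by rw [hgf, hcard]⟩
    rw [← hker, AddMonoidHom.mem_ker, Isogeny.coe_toAddMonoidHom]
  choose Bf hBf using hP
  -- one curve `B` occurs for infinitely many `n`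
  obtain ⟨B, hinf⟩ := Finite.exists_infinite_fiber Bf
  have hI : (Bf ⁻¹' {B}).Infinite := Set.infinite_coe_iff.mp hinf
  have hPB : ∀ n ∈ Bf ⁻¹' {B}, ∃ (_ : B.IsElliptic) (g : Isogeny W B) (f : Isogeny B W),
      (∀ P, g P = 0 ↔ P ∈ AddSubgroup.zmultiples (Literature.NumberTheory.EllipticCurves.TateModule.proj ℓ n v)) ∧
        (∀ P, f (g P) = ℓ ^ n • P) ∧ ∀ Q, g (f Q) = ℓ ^ n • Q := by
    intro n hn
    have h := hBf n
    rw [show Bf n = B from hn] at h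
    exact h
  obtain ⟨n₀, hn₀⟩ := hI.nonempty
  obtain ⟨_, g₀, f₀, -, -, hgf₀⟩ := hPB n₀ hn₀
  refine ⟨n₀, fun k ↦ ?_⟩
  obtain ⟨m, hmI, hkm⟩ := hI.exists_gt k
  obtain ⟨_, g, f, hker, hfg, hgf⟩ := hPB m hmI
  -- `φ = f_m ∘ g_{n₀}`
  have hTφ : ∀ x, Literature.NumberTheory.EllipticCurves.TateModule.map ℓ (f.comp g₀).toAddMonoidHom x =
      Literature.NumberTheory.EllipticCurves.TateModule.map ℓ f.toAddMonoidHom (Literature.NumberTheory.EllipticCurves.TateModule.map ℓ g₀.toAddMonoidHom x) := fun x ↦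
    Literature.NumberTheory.EllipticCurves.TateModule.ext fun j ↦ rfl
  refine ⟨f.comp g₀, ?_, fun x ↦ ?_⟩
  · -- the value `ℓ^{n₀} v = φ (f₀ y)` where `f_m y = v`
    obtain ⟨y, hy⟩ := exists_tateModule_map_eq_of_ker_eq ℓ hker hfg
    refine ⟨Literature.NumberTheory.EllipticCurves.TateModule.map ℓ f₀.toAddMonoidHom y, ?_⟩
    have h1 : Literature.NumberTheory.EllipticCurves.TateModule.map ℓ g₀.toAddMonoidHom (Literature.NumberTheory.EllipticCurves.TateModule.map ℓ f₀.toAddMonoidHom y) =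
        (ℓ : ℤ_[ℓ]) ^ n₀ • y := Literature.NumberTheory.EllipticCurves.TateModule.ext fun j ↦ by
      rw [Literature.NumberTheory.EllipticCurves.TateModule.proj_map, Literature.NumberTheory.EllipticCurves.TateModule.proj_map, Isogeny.coe_toAddMonoidHom,
        Isogeny.coe_toAddMonoidHom, hgf₀, Literature.NumberTheory.EllipticCurves.TateModule.proj_pow_smul]
    rw [hTφ, h1, map_smul, hy]
  · -- `φ(T) ⊆ f_m(T_ℓ B) ⊆ ℤ_ℓ v + ℓ^m T ⊆ ℤ_ℓ v + ℓ^k T`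
    obtain ⟨a, z, haz⟩ :=
      exists_tateModule_map_eq_add_of_ker_eq ℓ hker hgf (Literature.NumberTheory.EllipticCurves.TateModule.map ℓ g₀.toAddMonoidHom x)
    refine ⟨a, (ℓ : ℤ_[ℓ]) ^ (m - k) • z, ?_⟩
    rw [hTφ, haz, smul_smul, ← pow_add, Nat.add_sub_cancel' hkm.le]

end Literature.AlgebraicGeometry.Motives
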